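import Mathlib.Topology.Algebra.Group.Pointwise
import Mathlib.Topology.ClusterPt
import HarnessLib

/-!
# `⋂ᵢ C·Uᵢ = C·⋂ᵢ Uᵢ` for `C` compact and `(Uᵢ)` a decreasing family of closed sets in a topological group

Topic `Topology/Algebra`; namespace `Literature.Topology.Algebra`.  Theorems only (no definition, no named fact).

Let `G` be a topological group, `C ⊆ G` compact and `(Uᵢ)_{i ∈ ι}` an ANTITONE family of CLOSED subsets over a directed
non-empty index order.  Then `⋂ᵢ C·Uᵢ = C·(⋂ᵢ Uᵢ)` (`iInter_mul_eq_mul_iInter_of_isCompact`; multiplicative notation); in particular if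
`⋂ᵢ Uᵢ = {1}` (a neighbourhood basis of `1` by subgroups, e.g. principal congruence subgroups `K(N m)`, `m → ∞`, of a
compact open `K(N) ⊆ G(𝔸_f)`), then `⋂ᵢ C·Uᵢ = C` (`iInter_mul_eq_of_isCompact_of_iInter_eq`).  Proof: Bourbaki's
compactness argument — for `x = cᵢ uᵢ` (all `i`) a cluster point `a ∈ C` of `(cᵢ)` gives the cluster point `a⁻¹ x` of
`(uᵢ) = (cᵢ⁻¹ x)`, which lies in every closed `U_j ⊇ {uᵢ : i ≥ j}`.

Use (cell hodgecm-mathlib, row I-1′ `F1ExtHodgeType` v4 `stub_S2inj`, B-plan2's finiteness step F-ii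
«`⋂_m ũ(K̃(N′))·K_δ(N′m) = ũ(K̃(N′))`, compact · shrinking»).  HC_CM is proved only modulo the 7 printed citations until
rung 0 closes; this file proves no cell binder.

## References
* [BourbakiGT1] N. Bourbaki, *General Topology*, Ch. III §4 no. 1, Prop. 1 and Cor. 1 (products of a compact and a
  closed set in a topological group).
* [Deligne1971TravauxShimura] P. Deligne, *Travaux de Shimura* (1971), proof of Prop. 1.15 p. 132.
-/

open Set Filter Topology
open scoped Pointwise

namespace Literature.Topology.Algebra

variable {G : Type*} [TopologicalSpace G] [Group G] [IsTopologicalGroup G]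
variable {ι : Type*} [Preorder ι] [IsDirected ι (· ≤ ·)] [Nonempty ι]

/-- **`⋂ᵢ C·Uᵢ = C·⋂ᵢ Uᵢ`** for `C` compact and `(Uᵢ)` an antitone family of closed sets over a directed index
(Bourbaki's compactness argument with cluster points). [cite: BourbakiGT1, Ch. III §4 no. 1, Prop. 1 and Cor. 1] -/
theorem iInter_mul_eq_mul_iInter_of_isCompact {C : Set G} (hC : IsCompact C) {U : ι → Set G}
    (hU : ∀ i, IsClosed (U i)) (hanti : Antitone U) : (⋂ i, C * U i) = C * ⋂ i, U i := by
  refine Subset.antisymm ?_ ?_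
  · intro x hx
    rw [mem_iInter] at hx
    choose c hc u hu hcu using fun i => Set.mem_mul.1 (hx i)
    -- a cluster point `a ∈ C` of `(cᵢ)`
    haveI : (atTop : Filter ι).NeBot := atTop_neBot
    obtain ⟨a, haC, ha⟩ := hC.exists_clusterPt (f := map c atTop)
      (le_principal_iff.2 (mem_map.2 (Eventually.of_forall hc)))
    -- `b = a⁻¹ x` is a cluster point of `(uᵢ) = (cᵢ⁻¹ x)`
    set b := a⁻¹ * x with hb
    have hueq : u = fun i => (c i)⁻¹ * x := by
      funext i; rw [← hcu i, ← mul_assoc, inv_mul_cancel, one_mul]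
    have hcont : Continuous fun g : G => g⁻¹ * x := continuous_inv.mul continuous_const
    have hb' : ClusterPt b (map u atTop) := by
      have h1 : ClusterPt ((fun g : G => g⁻¹ * x) a) (map (fun g : G => g⁻¹ * x) (map c atTop)) :=
        ha.map hcont.continuousAt (tendsto_map)
      rw [map_map] at h1
      rw [hb, hueq]
      exact h1
    -- hence `b ∈ U j` for every `j` (closedness + eventual membership)
    have hbU : ∀ j, b ∈ U j := by
      intro j
      have hmem : u '' {i | j ≤ i} ∈ map u atTop := image_mem_map (mem_atTop j)
      have hcl := (clusterPt_iff_forall_mem_closure.1 hb') _ hmem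
      have hsub : u '' {i | j ≤ i} ⊆ U j := by
        rintro _ ⟨i, hi, rfl⟩; exact hanti hi (hu i)
      exact (hU j).closure_subset_iff.2 hsub hcl
    refine Set.mem_mul.2 ⟨a, haC, b, mem_iInter.2 hbU, ?_⟩
    rw [hb, ← mul_assoc, mul_inv_cancel, one_mul]
  · rintro _ ⟨a, ha, b, hb, rfl⟩
    rw [mem_iInter] at hb ⊢
    exact fun i => Set.mul_mem_mul ha (hb i)

/-- **`⋂ᵢ C·Uᵢ = C`** when moreover `⋂ᵢ Uᵢ = {1}` (e.g. `Uᵢ` a shrinking family of open — hence closed — subgroups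
with trivial intersection: «compact · shrinking levels»). [cite: BourbakiGT1, Ch. III §4 no. 1, Prop. 1 and Cor. 1]
[cite: Deligne1971TravauxShimura, proof of Prop. 1.15 p. 132] -/
theorem iInter_mul_eq_of_isCompact_of_iInter_eq {C : Set G} (hC : IsCompact C) {U : ι → Set G}
    (hU : ∀ i, IsClosed (U i)) (hanti : Antitone U) (hone : (⋂ i, U i) = {1}) : (⋂ i, C * U i) = C := by
  rw [iInter_mul_eq_mul_iInter_of_isCompact hC hU hanti, hone, Set.mul_singleton]
  simp

/-- Membership form: if `x ∈ C·Uᵢ` for all `i`, with `C` compact, `Uᵢ` antitone closed and `⋂ᵢ Uᵢ = {1}`,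
then `x ∈ C`. [cite: BourbakiGT1, Ch. III §4 no. 1, Prop. 1 and Cor. 1] -/
theorem mem_of_forall_mem_mul_of_isCompact {C : Set G} (hC : IsCompact C) {U : ι → Set G}
    (hU : ∀ i, IsClosed (U i)) (hanti : Antitone U) (hone : (⋂ i, U i) = {1}) {x : G} (hx : ∀ i, x ∈ C * U i) :
    x ∈ C := by
  rw [← iInter_mul_eq_of_isCompact_of_iInter_eq hC hU hanti hone, mem_iInter]
  exact hx

end Literature.Topology.Algebra
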